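import Mathlib
import Literature.Analysis.FluidPDE.IsometryInvariance
import Summits.NavierStokesRegularity.NavierStokesRegularity.Theorems.ThreadingFluxHorizonTowerZonalBridge
import Summits.NavierStokesRegularity.NavierStokesRegularity.Theorems.ThreadingFluxCentreJetHarmonicTangentRigidity
import HarnessLib

/-!
# Crux `PoloidalLiouville` (stmt-NavierStokesRegularity-1222, wall W1), crux idea «steady-centre-sieve» (ns-idea-15):
# FRAME + POLYNOMIAL FORM — from the jet facts to the algebraic core of L1 `TriaxialToroidalJetRigidity`

Support file (`--supports stmt-NavierStokesRegularity-1222`, helper; cell `ns-wall-extremal`, ns-wall-eng-7 g6, 0 kit).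
Layer (4) of the kernel proof of L1.  A smooth `k`-homogeneous field `P : ℝ³ → ℝ³` (`k ≠ 2`) which is tangent to the spheres
about `0`, divergence free, harmonic, and satisfies the loop law `⟪y, DP(y)[Sy] − S P(y)⟫ = 0` against a symmetric `S` with an
orthonormal eigenbasis `u` and DISTINCT eigenvalues `e` summing to `0`, VANISHES:

* `eq_zero_of_jetFacts_diag` — the case `S = diag(a)` in the standard frame: the components of `P` are homogeneous polynomials
  (ns-wall-eng-5 g4's `Zonal.exists_mvPolynomial_of_homogeneous`), the four facts become the four polynomial identities of
  `HarmonicTangent.harmonicTangentRigidity` (file (1)), which gives `P = 0`;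
* `eq_zero_of_jetFacts` — the general case, by conjugating with the linear isometry `g : eᵢ ↦ uᵢ`
  (`div`, `Δ`, `⟪·,·⟫` and the loop law are covariant: tree `Literature.Analysis.FluidPDE.IsometryInvariance`).

HONEST FRAME: helper theorem about one crux idea's objects; closes no crux or sketch Prop by itself; `PoloidalLiouville` (1222)
and NS regularity OPEN.
-/

-- the summit and its single sub-problem share the name (CONVENTIONS §1)
set_option linter.dupNamespace false

noncomputable section

namespace Summit.NavierStokesRegularity.NavierStokesRegularity.Theorems.PoloidalLiouville.CentreJet.TriaxialFrame

open Set Function MvPolynomial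
open scoped ContDiff RealInnerProductSpace
open Literature.Analysis.FluidPDE
open Literature.Geometry.DiscreteGeometry (inner_fin3)
open Summit.NavierStokesRegularity.NavierStokesRegularity.Theorems.PoloidalLiouville.HorizonTower.Zonal
  (evalE evalE_add evalE_mul evalE_X evalE_C evalE_sub evalE_zero fderiv_evalE_apply laplacian_evalE lapP
    eq_zero_of_evalE_eq_zero exists_mvPolynomial_of_homogeneous contDiff_evalE differentiable_evalE)

/-! ### Coordinates of derivatives on `ℝ³` -/

/-- Components of the derivative: `(DQ(y) v)ᵢ = D(Qᵢ)(y) v`. -/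
theorem fderiv_apply_coord {Q : E3 → E3} (hQ : Differentiable ℝ Q) (y v : E3) (i : Fin 3) :
    fderiv ℝ Q y v i = fderiv ℝ (fun z => Q z i) y v := by
  have h := ((EuclideanSpace.proj i : E3 →L[ℝ] ℝ).hasFDerivAt.comp y (hQ y).hasFDerivAt).fderiv
  have hc : (fun z => Q z i) = (EuclideanSpace.proj i : E3 →L[ℝ] ℝ) ∘ Q := rfl
  rw [hc, h]
  rfl

/-- Components of the Laplacian: `(ΔQ(y))ᵢ = Δ(Qᵢ)(y)` for `Q ∈ C²`. -/
theorem laplacian_apply_coord {Q : E3 → E3} (hQ : ContDiff ℝ 2 Q) (y : E3) (i : Fin 3) :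
    Laplacian.laplacian Q y i = Laplacian.laplacian (fun z => Q z i) y := by
  have h := (hQ.contDiffAt (x := y)).laplacian_CLM_comp_left (l := (EuclideanSpace.proj i : E3 →L[ℝ] ℝ))
  have hc : (fun z => Q z i) = (EuclideanSpace.proj i : E3 →L[ℝ] ℝ) ∘ Q := rfl
  rw [hc, h]
  rfl

/-! ### The diagonal frame: polynomial form and the algebraic core -/

/-- **Jet facts ⇒ zero, diagonal frame.**  A smooth `k`-homogeneous field on `ℝ³` (`k ≠ 2`), tangent to spheres, divergence free,
harmonic, with the loop law against `T = diag(a)` (`a` injective, `Σ aᵢ = 0`), vanishes. -/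
theorem eq_zero_of_jetFacts_diag (Q : E3 → E3) {k : ℕ} (hk : k ≠ 2) (hQ : ContDiff ℝ ∞ Q)
    (hhom : ∀ (c : ℝ) (y : E3), Q (c • y) = c ^ k • Q y) (hdiv : ∀ y, VectorCalculus.divergence Q y = 0)
    (htan : ∀ y, ⟪y, Q y⟫ = 0) (hharm : ∀ y, Laplacian.laplacian Q y = 0) (a : Fin 3 → ℝ) (ha : Function.Injective a)
    (hsum : ∑ i, a i = 0) (T : E3 →L[ℝ] E3) (hT : ∀ (w : E3) (i : Fin 3), T w i = a i * w i)
    (hloop : ∀ y, ⟪y, fderiv ℝ Q y (T y) - T (Q y)⟫ = 0) : Q = 0 := by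
  classical
  -- components as homogeneous polynomials
  have hcomp : ∀ i : Fin 3, ∃ q : MvPolynomial (Fin 3) ℝ, q.IsHomogeneous k ∧ ∀ y : E3, Q y i = evalE q y := by
    intro i
    refine exists_mvPolynomial_of_homogeneous ((EuclideanSpace.proj i : E3 →L[ℝ] ℝ).contDiff.comp hQ) ?_
    intro c y
    show Q (c • y) i = c ^ k * Q y i
    rw [hhom]; rfl
  choose q hqh hq using hcomp
  have hQd : Differentiable ℝ Q := hQ.differentiable (by simp)
  have hQi : ∀ i, (fun z => Q z i) = evalE (q i) := fun i => funext (hq i)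
  -- coordinates of `DQ` through the polynomials
  have hD : ∀ (y v : E3) (i : Fin 3), fderiv ℝ Q y v i = ∑ j : Fin 3, evalE (pderiv j (q i)) y * v j := by
    intro y v i
    rw [fderiv_apply_coord hQd, hQi i, fderiv_evalE_apply]
  -- (tan) `Σ Xᵢ qᵢ = 0`
  have ptan : ∑ i : Fin 3, X i * q i = 0 := by
    refine eq_zero_of_evalE_eq_zero fun y => ?_
    have h := htan y
    rw [inner_fin3, hq 0, hq 1, hq 2] at h
    simp only [Fin.sum_univ_three, evalE_add, evalE_mul, evalE_X]
    linarith
  -- (div) `Σ ∂ᵢ qᵢ = 0`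
  have pdiv : ∑ i : Fin 3, pderiv i (q i) = 0 := by
    refine eq_zero_of_evalE_eq_zero fun y => ?_
    have h := hdiv y
    rw [divergence_eq_sum_inner_fderiv (EuclideanSpace.basisFun (Fin 3) ℝ)] at h
    simp only [EuclideanSpace.basisFun_apply, EuclideanSpace.inner_single_left, map_one, one_mul, hD,
      PiLp.single_apply, mul_ite, mul_one, mul_zero, Finset.sum_ite_eq', Finset.mem_univ, if_true] at h
    simp only [Fin.sum_univ_three, evalE_add] at h ⊢
    exact h
  -- (harm) `Δ qᵢ = 0`
  have pharm : ∀ i, ∑ j : Fin 3, pderiv j (pderiv j (q i)) = 0 := by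
    intro i
    have hl : lapP (q i) = 0 := by
      refine eq_zero_of_evalE_eq_zero fun y => ?_
      have h := congrArg (fun w : E3 => w i) (hharm y)
      simp only at h
      rw [laplacian_apply_coord (hQ.of_le (by norm_cast)), hQi i, laplacian_evalE] at h
      rw [h]
      simp
    rw [Fin.sum_univ_three]
    exact hl
  -- (loop) `Σᵢ Xᵢ (Σⱼ aⱼ Xⱼ ∂ⱼqᵢ − aᵢ qᵢ) = 0`
  have ploop : ∑ i : Fin 3, X i * ((∑ j : Fin 3, C (a j) * X j * pderiv j (q i)) - C (a i) * q i) = 0 := by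
    refine eq_zero_of_evalE_eq_zero fun y => ?_
    have h := hloop y
    rw [inner_fin3] at h
    simp only [PiLp.sub_apply, hT, hD, hq, Fin.sum_univ_three] at h
    simp only [Fin.sum_univ_three, evalE_add, evalE_mul, evalE_sub, evalE_X, evalE_C]
    linarith
  -- the algebraic core
  have hq0 := HarmonicTangent.harmonicTangentRigidity a ha hsum hk q hqh ptan pdiv pharm ploop
  funext y
  ext i
  rw [hq i, show q i = 0 from congrFun hq0 i]
  simp

/-! ### An orthonormal triple is an orthonormal basis of `ℝ³` -/

/-- An orthonormal family `u : Fin 3 → ℝ³` is (the coercion of) an orthonormal basis. -/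
theorem exists_orthonormalBasis_eq {u : Fin 3 → E3} (hu : Orthonormal ℝ u) :
    ∃ ob : OrthonormalBasis (Fin 3) ℝ E3, ∀ i, ob i = u i := by
  have hcard : Fintype.card (Fin 3) = Module.finrank ℝ E3 := by simp
  let bu : Module.Basis (Fin 3) ℝ E3 := basisOfOrthonormalOfCardEqFinrank hu hcard
  have hbu : ⇑bu = u := coe_basisOfOrthonormalOfCardEqFinrank hu hcard
  refine ⟨bu.toOrthonormalBasis (by rw [hbu]; exact hu), fun i => ?_⟩
  rw [Module.Basis.coe_toOrthonormalBasis, hbu]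

/-- In an orthonormal eigenframe the trace is the sum of the eigenvalues: `div`-type sums `Σ ⟪uᵢ, S uᵢ⟫ = Σ eᵢ`. -/
theorem sum_inner_eigen {u : Fin 3 → E3} {e : Fin 3 → ℝ} (hu : Orthonormal ℝ u) (S : E3 →L[ℝ] E3)
    (hS : ∀ i, S (u i) = e i • u i) : ∑ i, ⟪u i, S (u i)⟫ = ∑ i, e i := by
  refine Finset.sum_congr rfl fun i _ => ?_
  rw [hS, real_inner_smul_right, real_inner_self_eq_norm_sq, hu.1 i]
  ring

/-! ### The general frame -/

/-- **Jet facts ⇒ zero.**  A smooth `k`-homogeneous field `P` on `ℝ³` (`k ≠ 2`), tangent to the spheres about `0`, divergence free,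
harmonic, satisfying the loop law `⟪y, DP(y)[Sy] − S P(y)⟫ = 0` for an `S` with an orthonormal eigenbasis `u` and injective eigenvalues
`e` with `Σ eᵢ = 0`, VANISHES. -/
theorem eq_zero_of_jetFacts (P : E3 → E3) {k : ℕ} (hk : k ≠ 2) (hP : ContDiff ℝ ∞ P)
    (hhom : ∀ (c : ℝ) (y : E3), P (c • y) = c ^ k • P y) (hdiv : ∀ y, VectorCalculus.divergence P y = 0)
    (htan : ∀ y, ⟪y, P y⟫ = 0) (hharm : ∀ y, Laplacian.laplacian P y = 0) (S : E3 →L[ℝ] E3) (u : Fin 3 → E3) (e : Fin 3 → ℝ)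
    (hu : Orthonormal ℝ u) (he : Function.Injective e) (hS : ∀ i, S (u i) = e i • u i) (htr : ∑ i, e i = 0)
    (hloop : ∀ y, ⟪y, fderiv ℝ P y (S y) - S (P y)⟫ = 0) : P = 0 := by
  classical
  -- the orthonormal eigenbasis as an `OrthonormalBasis`, and the frame isometry `g : eᵢ ↦ uᵢ`
  obtain ⟨ob, hob⟩ := exists_orthonormalBasis_eq hu
  set g : E3 ≃ₗᵢ[ℝ] E3 := ob.repr.symm with hg
  -- coordinates: `(g⁻¹ w)ᵢ = ⟪uᵢ, w⟫`, `g y = Σ yᵢ uᵢ`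
  have hgsymm : ∀ (w : E3) (i : Fin 3), g.symm w i = ⟪u i, w⟫ := fun w i => by
    rw [hg, LinearIsometryEquiv.symm_symm, ob.repr_apply_apply, hob]
  have hgy : ∀ y : E3, g y = ∑ i, y i • u i := fun y => by
    rw [hg, ← ob.sum_repr_symm]
    simp only [hob]
  -- the conjugated field and strain
  set Q : E3 → E3 := fun y => g.symm (P (g y)) with hQ
  set T : E3 →L[ℝ] E3 := (g.symm : E3 →L[ℝ] E3).comp (S.comp (g : E3 →L[ℝ] E3)) with hT
  have hTap : ∀ y, T y = g.symm (S (g y)) := fun y => rfl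
  have hTcoord : ∀ (w : E3) (i : Fin 3), T w i = e i * w i := by
    intro w i
    rw [hTap, hgsymm, hgy, map_sum]
    simp only [map_smul, hS, smul_smul, inner_sum, real_inner_smul_right]
    have horth : ∀ j, ⟪u i, u j⟫ = if i = j then (1 : ℝ) else 0 := fun j => by
      rw [orthonormal_iff_ite.mp hu i j]
    simp only [horth, mul_ite, mul_one, mul_zero, Finset.sum_ite_eq, Finset.mem_univ, if_true]
    ring
  -- facts for `Q`
  have hQs : ContDiff ℝ ∞ Q :=
    (g.symm : E3 →L[ℝ] E3).contDiff.comp (hP.comp (g : E3 →L[ℝ] E3).contDiff)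
  have hQhom : ∀ (c : ℝ) (y : E3), Q (c • y) = c ^ k • Q y := fun c y => by
    simp only [hQ, map_smul, hhom]
  have hQdiv : ∀ y, VectorCalculus.divergence Q y = 0 := fun y => by
    have h := divergence_conj_linearIsometryEquiv g.symm P y
    simp only [LinearIsometryEquiv.symm_symm] at h
    rw [hQ, h, hdiv]
  have hQtan : ∀ y, ⟪y, Q y⟫ = 0 := fun y => by
    rw [hQ]
    show ⟪y, g.symm (P (g y))⟫ = 0
    rw [← g.inner_map_map, LinearIsometryEquiv.apply_symm_apply, htan]
  have hQharm : ∀ y, Laplacian.laplacian Q y = 0 := fun y => by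
    have h := laplacian_conj_linearIsometryEquiv g.symm P y
    simp only [LinearIsometryEquiv.symm_symm] at h
    rw [hQ, h, hharm, map_zero]
  have hPd : Differentiable ℝ P := hP.differentiable (by simp)
  have hQloop : ∀ y, ⟪y, fderiv ℝ Q y (T y) - T (Q y)⟫ = 0 := fun y => by
    have hfd : fderiv ℝ Q y = (g.symm : E3 →L[ℝ] E3).comp ((fderiv ℝ P (g y)).comp (g : E3 →L[ℝ] E3)) := by
      have h := fderiv_conj_linearIsometryEquiv g.symm P y
      simp only [LinearIsometryEquiv.symm_symm] at h
      rw [hQ]; exact h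
    rw [hfd, hTap, hTap]
    show ⟪y, g.symm (fderiv ℝ P (g y) (g (g.symm (S (g y))))) - g.symm (S (g (g.symm (P (g y)))))⟫ = 0
    rw [LinearIsometryEquiv.apply_symm_apply, LinearIsometryEquiv.apply_symm_apply, ← map_sub, ← g.inner_map_map,
      LinearIsometryEquiv.apply_symm_apply, hloop]
  -- the diagonal case
  have hQ0 := eq_zero_of_jetFacts_diag Q hk hQs hQhom hQdiv hQtan hQharm e he htr T hTcoord hQloop
  funext x
  have h := congrFun hQ0 (g.symm x)
  simp only [hQ, LinearIsometryEquiv.apply_symm_apply, Pi.zero_apply] at h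
  simpa using h

end Summit.NavierStokesRegularity.NavierStokesRegularity.Theorems.PoloidalLiouville.CentreJet.TriaxialFrame

end
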